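import Literature.Computability.Cryptography.LWERegevLayout
import Literature.Computability.Cryptography.CoinChunks
import HarnessLib

/-!
# Regev's decision-to-search reduction, IV: the explicit algorithm on flat data and coins

Topic `Computability/Cryptography` (LWE), grouping namespace `LWE.RegevReduction`, continuing
`LWERegevLayout.lean` (numbering conventions, `assemble`) and `CoinChunks.lean` (reading
near-uniform scalars off a coin string). Here the reduction becomes an honest function

  `algOut D selT sel i₀ K S' r : ℤ_qⁿ`

of the flat tuple `S'` of `T (nq+1) N m` input samples and a coin string `r : List Bool` (the
scalar at position `p` is the `K`-bit chunk number `posEquiv p` of `r`, reduced mod `q`), exactly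
as the oracle machine of `regev_decision_to_search` (`LWEHardness.lean`) computes it, and its
failure probability over `S' ← A_{s,χ}^{m'}` and uniform coins is bounded:

* `sum_indicator_assemble_eq` — with EXACTLY uniform scalars the flat experiment is the outer
  experiment (`outerLaw_eq_map_assemble`), as an identity of real sums;
* **`sum_lweSamples_card_algOut_ne_le`** —
  `Pr_{S', r}[algOut ≠ s] ≤ Pr_{outerLaw}[output ≠ s] + L q / 2^K` (`L` = number of scalar
  positions, coins of any lengths `≥ K L`), by the domination estimate `sum_chunkVal_div_le`;
* **`one_sub_le_sum_lweSamples_card_algOut_eq`** — with the core bound of `LWERegevCore.lean`: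
  under an average-case advantage `ε` of `D`, accuracy `16η ≤ ε`, `q` prime,
  `Pr_{S', r}[algOut = s] ≥ 1 - (T (nq+1)/(4Nη²) + (1 - ε/2)^T + L q/2^K)` for EVERY secret `s`
  (Regev 2009, Lemma 4.1 "for all `s`" + Lemma 4.2).

## References

* O. Regev, *On lattices, learning with errors, random linear codes, and cryptography*, J. ACM 56
  (2009), art. 34, §4, Lemmas 4.1–4.2 (held: arXiv:2401.03703, p. 23). [cite: RegevLWE2009, §4 Lemma 4.1–4.2]
-/

noncomputable section

namespace Literature.Computability.Cryptography

namespace LWE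

namespace RegevReduction

open Finset Literature.Probability.Distributions
open scoped ENNReal

set_option synthInstance.maxSize 512

variable {n q m N T : ℕ} [NeZero q]

/-! ### The explicit algorithm -/

/-- The number of scalar positions: `T n` shift coordinates and one fresh scalar per sample slot.
[folklore] -/
theorem card_scalarPos : Fintype.card (ScalarPos n q m N T) = T * n + T * (n * q + 1) * N * m := by
  simp only [Fintype.card_sum, Fintype.card_prod, Fintype.card_fin, card_est]
  ring

/-- The scalars read off the coin string: position `p` is the `K`-bit chunk number `posEquiv p`,
as a binary number mod `q`. [cite: RegevLWE2009, §4 (proofs of Lemmas 4.1, 4.2: uniform t, l)] -/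
def scalarsOf (K : ℕ) (r : List Bool) : ScalarPos n q m N T → ZMod q :=
  fun p => chunkVal K q r (posEquiv n q m N T p)

/-- **Regev's reduction as a function of flat data**: the test `D`, the selectors, the reference
coordinate `i₀`, the chunk width `K`; input: the flat tuple of `T (nq+1) N m` samples (slot `u` is
sample number `slotEquiv u`) and the coin string. [cite: RegevLWE2009, §4 Lemma 4.1–4.2] -/
def algOut (D : Block n q m → Bool) (selT : (Fin T → ℕ) → Fin T) (sel : (ZMod q → ℕ) → ZMod q)
    (i₀ : Fin n) (K : ℕ) (S' : Fin (T * (n * q + 1) * N * m) → (Fin n → ZMod q) × ZMod q)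
    (r : List Bool) : Secret n q :=
  output D selT sel i₀ (assemble (scalarsOf K r) (S' ∘ slotEquiv n q m N T))

/-! ### Exactly uniform scalars: the flat experiment is the outer experiment -/

/-- Reindexing the input tuple along `slotEquiv` carries `A_{s,χ}^{m'}` to the product law on slots,
pointwise: `piLaw A (S' ∘ σ) = lweSamples … S'`. [folklore] -/
theorem piLaw_comp_slotEquiv (χ : PMF (ZMod q)) (s : Secret n q)
    (S' : Fin (T * (n * q + 1) * N * m) → (Fin n → ZMod q) × ZMod q) :
    piLaw (fun _ : QIdx n q N T × Fin m => lweSample χ s) (S' ∘ slotEquiv n q m N T) =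
      lweSamples χ s (T * (n * q + 1) * N * m) S' := by
  classical
  rw [← iidPMF_map_comp_equiv (lweSample χ s) (slotEquiv n q m N T), lweSamples]
  exact pmf_map_apply_of_injective _ (Equiv.arrowCongr (slotEquiv n q m N T) (Equiv.refl _)).symm.injective S'

/-- **With exactly uniform scalars the flat experiment has the outer law**: for any event `E`,
`∑_{S'} A^{m'}(S') · (#{v | E (assemble v (S' ∘ σ))} / q^L) = Pr_{outerLaw}[E]`.
[cite: RegevLWE2009, §4 Lemma 4.1–4.2] -/
theorem sum_indicator_assemble_eq (χ : PMF (ZMod q)) (s : Secret n q) (E : Outer n q m N T → Prop)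
    [DecidablePred E] :
    ∑ S' : Fin (T * (n * q + 1) * N * m) → (Fin n → ZMod q) × ZMod q,
        (lweSamples χ s _ S').toReal *
          ((∑ v : ScalarPos n q m N T → ZMod q, if E (assemble v (S' ∘ slotEquiv n q m N T)) then (1 : ℝ) else 0) /
            (q : ℝ) ^ Fintype.card (ScalarPos n q m N T)) =
      ((outerLaw χ s (m := m) N T).toOuterMeasure {Ω | E Ω}).toReal := by
  classical
  set σ := slotEquiv n q m N T with hσ
  set P : PMF (ScalarPos n q m N T → ZMod q) := piLaw fun _ => PMF.uniformOfFintype (ZMod q) with hP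
  set R : PMF (QIdx n q N T × Fin m → (Fin n → ZMod q) × ZMod q) := piLaw fun _ => lweSample χ s with hR
  have hPv : ∀ v, P v = ((q : ℝ≥0∞)⁻¹) ^ Fintype.card (ScalarPos n q m N T) := fun v => by
    rw [hP, piLaw_apply]
    simp only [PMF.uniformOfFintype_apply, ZMod.card, prod_const, card_univ]
  -- the outer probability as a double sum over (scalars, slot samples)
  rw [outerLaw_eq_map_assemble, PMF.toOuterMeasure_map_apply, PMF.toOuterMeasure_apply_fintype,
    Fintype.sum_prod_type]
  have hfin : ∀ (v : ScalarPos n q m N T → ZMod q) (S : QIdx n q N T × Fin m → (Fin n → ZMod q) × ZMod q),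
      ((fun p : (ScalarPos n q m N T → ZMod q) × (QIdx n q N T × Fin m → (Fin n → ZMod q) × ZMod q) =>
          assemble p.1 p.2) ⁻¹' {Ω | E Ω}).indicator (prodLaw P R) (v, S) ≠ ⊤ := fun v S =>
    ne_of_lt (lt_of_le_of_lt (Set.indicator_le_self _ _ _) (PMF.apply_lt_top _ _))
  rw [ENNReal.toReal_sum fun v _ => ENNReal.sum_ne_top.2 fun S _ => hfin v S,
    Finset.sum_congr rfl fun v _ => ENNReal.toReal_sum fun S _ => hfin v S, Finset.sum_comm]
  -- pass from input tuples to slot samples along `S' ↦ S' ∘ σ`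
  have hbij : Function.Bijective fun S' : Fin (T * (n * q + 1) * N * m) → (Fin n → ZMod q) × ZMod q => S' ∘ σ :=
    (Equiv.arrowCongr σ (Equiv.refl _)).symm.bijective
  refine Fintype.sum_bijective _ hbij _ _ fun S' => ?_
  rw [← mul_div_assoc, Finset.mul_sum, Finset.sum_div]
  refine Finset.sum_congr rfl fun v _ => ?_
  by_cases hE : E (assemble v (S' ∘ σ))
  · rw [if_pos hE, Set.indicator_of_mem (show (v, S' ∘ σ) ∈
        (fun p : (ScalarPos n q m N T → ZMod q) × (QIdx n q N T × Fin m → (Fin n → ZMod q) × ZMod q) =>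
          assemble p.1 p.2) ⁻¹' {Ω | E Ω} from hE),
      prodLaw_apply, hPv, hR, piLaw_comp_slotEquiv, ENNReal.toReal_mul, ENNReal.toReal_pow,
      ENNReal.toReal_inv, ENNReal.toReal_natCast, mul_one, inv_pow, div_eq_inv_mul]
  · rw [if_neg hE, Set.indicator_of_notMem (show (v, S' ∘ σ) ∉
        (fun p : (ScalarPos n q m N T → ZMod q) × (QIdx n q N T × Fin m → (Fin n → ZMod q) × ZMod q) =>
          assemble p.1 p.2) ⁻¹' {Ω | E Ω} from hE),
      ENNReal.toReal_zero, mul_zero, zero_div]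

/-! ### Near-uniform scalars from coins: the failure probability of `algOut` -/

/-- **`Pr_{S', r}[algOut ≠ s] ≤ Pr_{outerLaw}[output ≠ s] + L q / 2^K`** for coin strings of any
lengths `C(S') ≥ K L` (`L = T n + T (nq+1) N m` scalar positions): the domination estimate
`sum_chunkVal_div_le` for each input tuple, then `sum_indicator_assemble_eq`.
[cite: RegevLWE2009, §4 Lemma 4.1–4.2] -/
theorem sum_lweSamples_card_algOut_ne_le (χ : PMF (ZMod q)) (s : Secret n q) (D : Block n q m → Bool)
    (selT : (Fin T → ℕ) → Fin T) (sel : (ZMod q → ℕ) → ZMod q) (i₀ : Fin n) (K : ℕ)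
    {C : (Fin (T * (n * q + 1) * N * m) → (Fin n → ZMod q) × ZMod q) → ℕ}
    (hC : ∀ S', K * (T * n + T * (n * q + 1) * N * m) ≤ C S') :
    ∑ S', (lweSamples χ s _ S').toReal *
        ((#{r : List.Vector Bool (C S') | algOut D selT sel i₀ K S' r.toList ≠ s} : ℝ) / 2 ^ C S') ≤
      ((outerLaw χ s (m := m) N T).toOuterMeasure {Ω | output D selT sel i₀ Ω ≠ s}).toReal +
        (T * n + T * (n * q + 1) * N * m : ℕ) * q / 2 ^ K := by
  classical
  set L := T * n + T * (n * q + 1) * N * m with hL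
  set σ := slotEquiv n q m N T with hσ
  have hcard : Fintype.card (ScalarPos n q m N T) = L := card_scalarPos
  -- termwise domination
  have hterm : ∀ S' : Fin (T * (n * q + 1) * N * m) → (Fin n → ZMod q) × ZMod q,
      (#{r : List.Vector Bool (C S') | algOut D selT sel i₀ K S' r.toList ≠ s} : ℝ) / 2 ^ C S' ≤
        (∑ v : ScalarPos n q m N T → ZMod q,
            if output D selT sel i₀ (assemble v (S' ∘ σ)) ≠ s then (1 : ℝ) else 0) / (q : ℝ) ^ L +
          L * q / 2 ^ K := by
    intro S'
    have h := sum_chunkVal_div_le (q := q) (posEquiv n q m N T) (hC S')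
      (fun v => if output D selT sel i₀ (assemble v (S' ∘ σ)) ≠ s then (1 : ℝ) else 0)
      (fun v => by split_ifs <;> norm_num) (fun v => by split_ifs <;> norm_num)
    rw [hcard] at h
    refine le_trans (le_of_eq ?_) h
    rw [natCast_card_filter]
    rfl
  have hw : ∀ S' : Fin (T * (n * q + 1) * N * m) → (Fin n → ZMod q) × ZMod q,
      0 ≤ (lweSamples χ s _ S').toReal := fun S' => ENNReal.toReal_nonneg
  have hsum1 : ∑ S' : Fin (T * (n * q + 1) * N * m) → (Fin n → ZMod q) × ZMod q,
      (lweSamples χ s _ S').toReal = 1 := by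
    rw [← ENNReal.toReal_sum fun S' _ => PMF.apply_ne_top _ _, ← tsum_fintype (L := SummationFilter.unconditional _),
      PMF.tsum_coe, ENNReal.toReal_one]
  calc ∑ S', (lweSamples χ s _ S').toReal *
        ((#{r : List.Vector Bool (C S') | algOut D selT sel i₀ K S' r.toList ≠ s} : ℝ) / 2 ^ C S')
      ≤ ∑ S', (lweSamples χ s _ S').toReal *
          ((∑ v : ScalarPos n q m N T → ZMod q,
              if output D selT sel i₀ (assemble v (S' ∘ σ)) ≠ s then (1 : ℝ) else 0) / (q : ℝ) ^ L +
            L * q / 2 ^ K) := Finset.sum_le_sum fun S' _ => mul_le_mul_of_nonneg_left (hterm S') (hw S')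
    _ = ∑ S', (lweSamples χ s _ S').toReal *
          ((∑ v : ScalarPos n q m N T → ZMod q,
              if output D selT sel i₀ (assemble v (S' ∘ σ)) ≠ s then (1 : ℝ) else 0) / (q : ℝ) ^ L) +
        (∑ S', (lweSamples χ s _ S').toReal) * (L * q / 2 ^ K) := by
          rw [Finset.sum_mul, ← Finset.sum_add_distrib]
          refine Finset.sum_congr rfl fun S' _ => ?_
          ring
    _ = ((outerLaw χ s (m := m) N T).toOuterMeasure {Ω | output D selT sel i₀ Ω ≠ s}).toReal + L * q / 2 ^ K := by
          rw [hsum1, one_mul, ← hcard, sum_indicator_assemble_eq χ s fun Ω => output D selT sel i₀ Ω ≠ s]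

/-- **Success of the explicit reduction, for every secret** (Regev 2009, Lemmas 4.1 + 4.2,
quantitative): if the deterministic test `D` has average-case advantage `≥ ε` against
`LWE_{q,χ}` on `m` samples (`q` prime), then with `16 η ≤ ε`, `N ≥ 1`, any maximum/minimum
selectors and coin strings of lengths `≥ K L`,
`Pr_{S' ← A_{s,χ}^{m'}, r}[algOut = s] ≥ 1 - (T (nq+1)/(4Nη²) + (1 - ε/2)^T + L q / 2^K)`.
[cite: RegevLWE2009, §4 Lemma 4.1–4.2] -/
theorem one_sub_le_sum_lweSamples_card_algOut_eq [Fact q.Prime] (χ : PMF (ZMod q)) (s : Secret n q)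
    (D : Block n q m → Bool) (hN : 0 < N) {η ε : ℝ} (hη : 0 < η) (hηε : 16 * η ≤ ε)
    (hε : ε ≤ distinguishingAdvantage χ m fun b : Block n q m => PMF.pure (D b))
    {selT : (Fin T → ℕ) → Fin T} (hselT : IsMaxSel selT) {sel : (ZMod q → ℕ) → ZMod q}
    (hsel : IsMinSel sel) (i₀ : Fin n) (K : ℕ)
    {C : (Fin (T * (n * q + 1) * N * m) → (Fin n → ZMod q) × ZMod q) → ℕ}
    (hC : ∀ S', K * (T * n + T * (n * q + 1) * N * m) ≤ C S') :
    1 - (T * ((n * q + 1) / (4 * N * η ^ 2)) + (1 - ε / 2) ^ T + (T * n + T * (n * q + 1) * N * m : ℕ) * q / 2 ^ K) ≤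
      ∑ S', (lweSamples χ s _ S').toReal *
        ((#{r : List.Vector Bool (C S') | algOut D selT sel i₀ K S' r.toList = s} : ℝ) / 2 ^ C S') := by
  classical
  rw [distinguishingAdvantage_pure_eq] at hε
  have hcore := outerLaw_output_ne_le_of_advantage (χ := χ) (s := s) (T := T) D hN hη hηε hε hselT hsel i₀
  have hfail := sum_lweSamples_card_algOut_ne_le χ s D selT sel i₀ K hC
  -- the complementary counts
  have hcompl : ∀ S' : Fin (T * (n * q + 1) * N * m) → (Fin n → ZMod q) × ZMod q,
      (#{r : List.Vector Bool (C S') | algOut D selT sel i₀ K S' r.toList = s} : ℝ) / 2 ^ C S' =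
        1 - (#{r : List.Vector Bool (C S') | algOut D selT sel i₀ K S' r.toList ≠ s} : ℝ) / 2 ^ C S' := by
    intro S'
    have h := Finset.card_filter_add_card_filter_not (s := (univ : Finset (List.Vector Bool (C S'))))
      (fun r => algOut D selT sel i₀ K S' r.toList = s)
    rw [card_univ, card_vector, Fintype.card_bool] at h
    have h2 : (0 : ℝ) < 2 ^ C S' := by positivity
    rw [eq_sub_iff_add_eq, ← add_div, div_eq_one_iff_eq h2.ne']
    exact_mod_cast h
  have hsum1 : ∑ S' : Fin (T * (n * q + 1) * N * m) → (Fin n → ZMod q) × ZMod q,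
      (lweSamples χ s _ S').toReal = 1 := by
    rw [← ENNReal.toReal_sum fun S' _ => PMF.apply_ne_top _ _, ← tsum_fintype (L := SummationFilter.unconditional _),
      PMF.tsum_coe, ENNReal.toReal_one]
  simp_rw [hcompl, mul_sub, mul_one, Finset.sum_sub_distrib, hsum1]
  -- the ideal failure probability is at most the core bound
  have hreal : ((outerLaw χ s (m := m) N T).toOuterMeasure {Ω | output D selT sel i₀ Ω ≠ s}).toReal ≤
      T * ((n * q + 1) / (4 * N * η ^ 2)) + (1 - ε / 2) ^ T := by
    have hb : 0 ≤ T * ((n * q + 1) / (4 * N * η ^ 2)) + (1 - ε / 2) ^ T := by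
      have hε1 : ε ≤ 1 := hε.trans (by
        rw [← distinguishingAdvantage_pure_eq]
        exact distinguishingAdvantage_le_one_holds χ m _)
      have h0 : 0 ≤ 1 - ε / 2 := by linarith
      positivity
    exact ENNReal.toReal_le_of_le_ofReal hb hcore
  linarith

end RegevReduction

end LWE

end Literature.Computability.Cryptography

end
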